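import Summits.ResolutionOfSingularities.ResolutionOfSingularities.Theorems.MarkedTransferCampaignW46PlaneProcrastinationCentre
import Literature.AlgebraicGeometry.Resolution.DivisorialPart
import Literature.AlgebraicGeometry.Resolution.OrderSemicontinuity
import Literature.AlgebraicGeometry.Resolution.QuasiExcellentSchemes
import Literature.AlgebraicGeometry.Resolution.ExcellentRingsFieldProofs
import Literature.AlgebraicGeometry.Resolution.FibreDimensionOne
import Literature.Topology.KrullDimensionDrop
import HarnessLib

/-!
# [OURS · L1 W4.6 rung (i-b)] FINITENESS: on a surface state only finitely many points have positive measure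
# (cell res-hironaka, LADDER-RESOLUTION rung L, D-0089; campaign s46, prover res-L1-s46-pv-1; host route MarkedTransfer,
# `--supports stmt-ResolutionOfSingularities-16155`)

HONEST FRAMING. Nothing here is a statement of H. Hironaka's manuscript (2017-03-23, [Hironaka2017]); OURS bookkeeping over the
tree's divisorial decomposition of an ideal sheaf on a regular scheme (`DivisorialPart.lean`: `J = H · J₂`, `H = ∏ 𝓘_{E_i}^{a_i}`,
`V(J₂)` of codimension `≥ 2`), upper semicontinuity of the order (`OrderSemicontinuity.lean`, excellence of schemes of finite
type over a field `Stacks07QW_field_holds`) and elementary dimension theory of Noetherian sober spaces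
(`Literature.Topology.KrullDimensionDrop`, `FibreDimensionOne.lean`). AI-written; weaker than expert review. No `sorry`;
axioms standard.

## What

For an ambient surface `Z` (`topologicalKrullDim Z ≤ 2`) and a standard ideal exponent `E = (J, b)`, the set of points `y`
with `μ(A, E, y) > 0` (`μ = looseGermMeasure`: the loose exit count of the normal form of `J_y`) is FINITE. At a point `y`
off `V(J₂)` lying on exactly one prime divisor `E_i` of `V(J)` which is regular at `y`, `J_y = (p^{a_i})` with `p` a regular
parameter, whose normal form contains `p^{a_i mod b} ∉ 𝔪^b` — so `μ = 0`; the remaining points lie in `V(J₂)`, in an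
intersection `E_i ∩ E_j`, or in the singular locus of some `E_i`: closed sets of points of codimension `≥ 2`, finite on a
surface (`finite_of_isClosed_of_forall_two_le_coheight`).

## References

* V. Cossart, O. Piltant, J. Algebra 320 (2008), proof of Prop. 4.2. [CossartPiltant2008]
* O. Zariski, P. Samuel, *Commutative Algebra* II (1960), Appendix 5. [ZariskiSamuel1960]
-/

noncomputable section

set_option linter.dupNamespace false -- mandated namespace of this single-conjunct summit

open CategoryTheory AlgebraicGeometry TopologicalSpace IsLocalRing

namespace Summit.ResolutionOfSingularities.ResolutionOfSingularities.Theorems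

namespace CampaignW46

open Literature.AlgebraicGeometry.Resolution
open Literature.AlgebraicGeometry.Hironaka2017.S02Preliminaries
open Scheme.IdealSheafData

universe u

/-! ## A closed set of points of codimension `≥ 2` on a surface is finite -/

/-- **On a Noetherian sober space of dimension `≤ 2`, a closed set all of whose points have codimension `≥ 2` is finite**:
two of its points never specialise strictly to one another (the codimension would jump to `3`), so its subspace dimension
is `≤ 0`. [folklore] -/
theorem finite_of_isClosed_of_forall_two_le_coheight {Z : Scheme.{u}} [NoetherianSpace Z] (hdim : topologicalKrullDim Z ≤ 2)
    {S : Set Z} (hS : IsClosed S) (h2 : ∀ y ∈ S, (2 : ℕ∞) ≤ Order.coheight y) : S.Finite := by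
  haveI : QuasiSober S := Literature.Topology.quasiSober_of_isClosed hS
  refine finite_of_isClosed_of_topologicalKrullDim_le_zero hS ?_
  rw [Literature.Topology.topologicalKrullDim_eq_krullDim,
    @Order.krullDim_nonpos_iff_forall_isMax _ (specializationOrder S).toPreorder]
  intro a b hab
  -- `hab : a ≤ b` in the specialisation order of `S`, i.e. `b ⤳ a` in `S`, hence in `Z`
  have hab₀ : (b : S) ⤳ a := hab
  have hba : (b : Z) ⤳ (a : Z) := (Topology.IsInducing.subtypeVal.specializes_iff).mpr hab₀
  by_contra hnot
  have hab' : ¬ (a : Z) ⤳ (b : Z) := fun h => hnot ((Topology.IsInducing.subtypeVal.specializes_iff).mp h)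
  have hlt : (a : Z) < (b : Z) := lt_of_le_not_ge (Scheme.le_iff_specializes.mpr hba) fun h =>
    hab' (Scheme.le_iff_specializes.mp h)
  have h1 := Order.coheight_add_one_le hlt
  have h3 : (2 : ℕ∞) + 1 ≤ Order.coheight (a : Z) := (add_le_add (h2 b b.2) le_rfl).trans h1
  have h4 : ((Order.coheight (a : Z) : ℕ∞) : WithBot ℕ∞) ≤ ((2 : ℕ∞) : WithBot ℕ∞) := by
    have h := coe_height_add_coheight_le_topologicalKrullDim (a : Z)
    have h' : ((Order.coheight (a : Z) : ℕ∞) : WithBot ℕ∞) ≤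
        ((Order.height (a : Z) + Order.coheight (a : Z) : ℕ∞) : WithBot ℕ∞) := WithBot.coe_le_coe.mpr le_add_self
    exact h'.trans (h.trans hdim)
  have h5 : Order.coheight (a : Z) ≤ 2 := WithBot.coe_le_coe.mp h4
  have h6 : (2 : ℕ∞) + 1 ≤ 2 := h3.trans h5
  exact absurd h6 (by decide)

/-! ## Vanishing of the measure -/

/-- A node which is not singular has empty loose tree. [folklore] -/
theorem looseExitCount_eq_zero_of_not_isSingularNode {K : Type u} [Field K] {b : ℕ} {S : Subring K} {J : Ideal S}
    (hns : ¬ IsSingularNode b (⟨S, J⟩ : MarkedNode K)) : looseExitCount b S J = 0 := by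
  have hni : ¬ IsIsolatedNode b (⟨S, J⟩ : MarkedNode K) := fun hi => hns hi.isSingularNode
  rw [looseExitCount, Set.ncard_eq_zero (finite_looseExitTree b _)]
  ext n
  simp only [Set.mem_empty_iff_false, iff_false]
  intro hn
  have := looseExitTree_subset_singleton_of_not_isIsolatedNode hni hn
  rw [Set.mem_singleton_iff] at this
  subst this
  exact hns hn.2

/-- **The measure vanishes unless the normal form is singular**: if `normalForm b I ⊄ 𝔪^b` then `μ(R, I, b) = 0` (for a
local domain `R`). [folklore] -/
theorem looseGermMeasure_eq_zero_of_not_le {R : Type u} [CommRing R] [IsLocalRing R] [IsDomain R] {b : ℕ} {I : Ideal R}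
    (h : ¬ normalForm b I ≤ maximalIdeal R ^ b) : looseGermMeasure R I b = 0 := by
  rw [looseGermMeasure_eq]
  set ι := algebraMap R (FractionRing R) with hι
  have hinj : Function.Injective ι := IsFractionRing.injective R (FractionRing R)
  have hfrac : ∀ z : FractionRing R, ∃ a c : R, ι c ≠ 0 ∧ z = ι a / ι c := fun z => by
    obtain ⟨a, c, hc, hz⟩ := IsFractionRing.div_surjective (A := R) z
    exact ⟨a, c, IsFractionRing.to_map_ne_zero_of_mem_nonZeroDivisors hc, hz.symm⟩
  rw [germLooseExitCount_eq_looseExitCount ι hinj hfrac]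
  refine looseExitCount_eq_zero_of_not_isSingularNode fun hs => h ?_
  obtain ⟨hregR, -, -, hle⟩ := hs
  haveI := hregR
  -- pull `hle` back along `R ≃ ι.range`
  have hbij : Function.Bijective ι.rangeRestrict := ⟨fun _ _ e => hinj (congrArg Subtype.val e), ι.rangeRestrict_surjective⟩
  let eR : R ≃+* ι.range := RingEquiv.ofBijective ι.rangeRestrict hbij
  have hmax : (maximalIdeal R).map (eR : R →+* ι.range) = maximalIdeal ι.range := IsLocalRing.map_ringEquiv_maximalIdeal eR
  have h1 := Ideal.comap_mono (f := ι.rangeRestrict) hle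
  rw [Ideal.comap_map_of_bijective _ hbij, ← hmax, ← Ideal.map_pow,
    show (maximalIdeal R ^ b).map (eR : R →+* ι.range) = (maximalIdeal R ^ b).map ι.rangeRestrict from rfl,
    Ideal.comap_map_of_bijective _ hbij] at h1
  exact h1

/-- **A principal power of a regular parameter has non-singular normal form**: for a prime `p ∉ 𝔪²` of a regular local ring and
`b > 0`, `normalForm b (p^a) ⊄ 𝔪^b` (it contains `p^{a mod b}`). [folklore] -/
theorem normalForm_span_pow_not_le {R : Type u} [CommRing R] [IsRegularLocalRing R] {b : ℕ} (hb : 0 < b) {p : R}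
    (hp : Prime p) (hp2 : p ∉ maximalIdeal R ^ 2) (a : ℕ) :
    ¬ normalForm b (Ideal.span {p ^ a}) ≤ maximalIdeal R ^ b := by
  intro hle
  set c := a / b with hc
  have hbc : b * c ≤ a := Nat.mul_div_le a b
  have hadm : IsAdmissibleDivisor b (p ^ (b * c)) := by
    refine ⟨Multiset.replicate c p, fun σ hσ => ?_, ?_⟩
    · rw [Multiset.eq_of_mem_replicate hσ]; exact ⟨hp, hp2⟩
    · rw [Multiset.map_replicate, Multiset.prod_replicate, ← pow_mul]
  have hJd : Ideal.span {p ^ a} ≤ Ideal.span {p ^ (b * c)} :=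
    Ideal.span_singleton_le_span_singleton.mpr (pow_dvd_pow p hbc)
  have hmem : p ^ (a - b * c) ∈ normalForm b (Ideal.span {p ^ a}) := by
    refine colon_le_normalForm hadm hJd ?_
    rw [Submodule.mem_colon]
    intro q hq
    obtain ⟨t, rfl⟩ := Ideal.mem_span_singleton'.mp hq
    rw [smul_eq_mul, show p ^ (a - b * c) * (t * p ^ (b * c)) = t * (p ^ (a - b * c) * p ^ (b * c)) by ring, ← pow_add,
      Nat.sub_add_cancel hbc]
    exact Ideal.mul_mem_left _ _ (Ideal.mem_span_singleton_self _)
  have hlt : a - b * c < b := by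
    have h1 := Nat.div_add_mod a b
    have h2 := Nat.mod_lt a hb
    rw [← hc] at h1
    omega
  have hnot := pow_not_mem_pow_of_not_mem_pow (p := 1) hp2 (a - b * c)
  rw [mul_one] at hnot
  exact hnot (Ideal.pow_le_pow_right (by omega) (hle hmem))

/-! ## The finiteness theorem -/

variable {p : ℕ} [Fact p.Prime] {K : Type u} [Field K] [CharP K p]

/-- **FINITENESS OF THE POSITIVE LOCUS OF THE MEASURE ON A SURFACE.** For an ambient scheme `Z` with `topologicalKrullDim Z ≤ 2`
and a standard ideal exponent `E = (J, b)`, only finitely many points `y` of `Z` have `μ(A, E, y) > 0`, `μ = looseGermMeasure` at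
the stalk. [cite: CossartPiltant2008, proof of Prop. 4.2] -/
theorem finite_setOf_looseGermMeasure_pos (A : AmbientDatum p K) (E : IdealExponent A.Z) (hE : E.IsStandard)
    (hdimZ : topologicalKrullDim A.Z ≤ 2) :
    {y : A.Z | 0 < looseGermMeasure (A.Z.presheaf.stalk y) (stalkIdeal E.J y) E.b}.Finite := by
  classical
  haveI := ambient_isIntegral A
  haveI := A.smooth
  haveI := A.quasiCompact
  haveI : IsLocallyNoetherian A.Z := ambient_isLocallyNoetherian A
  haveI : CompactSpace A.Z := QuasiCompact.compactSpace_of_compactSpace A.hom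
  haveI : IsNoetherian A.Z := {}
  have hX : Scheme.IsRegular A.Z := ambient_isRegular A
  have hXe : Scheme.IsExcellent A.Z := Scheme.isExcellent_of_locallyOfFiniteType Stacks07QW_field_holds A.hom
  set J := E.J with hJdef
  have hJ : J ≠ ⊥ := hE.1
  have hb : 0 < E.b := hE.2
  have hfin := finite_divisorialPoints (I := J) hJ
  set F := hfin.toFinset with hF
  have hmemF : ∀ ζ, ζ ∈ F ↔ ζ ∈ divisorialPoints J := fun ζ => Set.Finite.mem_toFinset hfin
  -- the three exceptional closed sets
  set S₁ : Set A.Z := ((codimTwoPart J).support : Set A.Z) with hS₁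
  set S₂ : Set A.Z := ⋃ ζ ∈ F, ⋃ ζ' ∈ F, if ζ = ζ' then ∅ else closure {ζ} ∩ closure {ζ'} with hS₂
  set S₃ : Set A.Z := ⋃ ζ ∈ F, closure {ζ} ∩ {y | ((2 : ℕ) : ℕ∞) ≤ idealOrder (primeDivisorIdeal ζ) y} with hS₃
  -- codimension-one points specialise strictly only to points of codimension `≥ 2`
  have hcoh2 : ∀ ζ ∈ F, ∀ y, ζ ⤳ y → y ≠ ζ → (2 : ℕ∞) ≤ Order.coheight y := by
    intro ζ hζ y hsp hne
    have hζ1 : Order.coheight ζ = 1 := ((hmemF ζ).mp hζ).2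
    have hlt : y < ζ := lt_of_le_not_ge (Scheme.le_iff_specializes.mpr hsp) fun h =>
      hne ((Scheme.le_iff_specializes.mp h).antisymm hsp).eq
    have := Order.coheight_add_one_le hlt
    rw [hζ1] at this
    exact this
  -- finiteness of the three sets
  have hfin₁ : S₁.Finite := by
    refine finite_of_isClosed_of_forall_two_le_coheight hdimZ (codimTwoPart J).support.isClosed fun y hy => ?_
    exact Order.add_one_le_of_lt (one_lt_coheight_of_mem_support_codimTwoPart hX hJ hy)
  have hfin₂ : S₂.Finite := by
    refine Set.Finite.biUnion F.finite_toSet fun ζ hζ => Set.Finite.biUnion F.finite_toSet fun ζ' hζ' => ?_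
    split_ifs with h
    · exact Set.finite_empty
    · refine finite_of_isClosed_of_forall_two_le_coheight hdimZ (isClosed_closure.inter isClosed_closure) fun y hy => ?_
      have h1 : ζ ⤳ y := specializes_iff_mem_closure.mpr hy.1
      have h2 : ζ' ⤳ y := specializes_iff_mem_closure.mpr hy.2
      refine hcoh2 ζ (Finset.mem_coe.mp hζ) y h1 fun hyζ => ?_
      subst hyζ
      exact not_specializes_of_coheight_eq_one ((hmemF ζ').mp (Finset.mem_coe.mp hζ')).2
        ((hmemF y).mp (Finset.mem_coe.mp hζ)).2 (Ne.symm h) h2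
  have hfin₃ : S₃.Finite := by
    refine Set.Finite.biUnion F.finite_toSet fun ζ hζ => ?_
    have hζ' := (hmemF ζ).mp (Finset.mem_coe.mp hζ)
    have hPne : primeDivisorIdeal ζ ≠ ⊥ := by
      intro h0
      have hgen : genericPoint A.Z ∈ ((primeDivisorIdeal ζ).support : Set A.Z) := by
        rw [h0]; simp
      rw [coe_support_primeDivisorIdeal] at hgen
      have hsp : ζ ⤳ genericPoint A.Z := specializes_iff_mem_closure.mpr hgen
      have heq : ζ = genericPoint A.Z :=
        (hsp.antisymm ((genericPoint_spec A.Z).specializes (Set.mem_univ ζ))).eq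
      have h0' : Order.coheight ζ = 0 := by
        rw [heq, Order.coheight_eq_zero]
        intro y _
        exact Scheme.le_iff_specializes.mpr ((genericPoint_spec A.Z).specializes (Set.mem_univ y))
      rw [hζ'.2] at h0'
      exact one_ne_zero h0'
    refine finite_of_isClosed_of_forall_two_le_coheight hdimZ
      (isClosed_closure.inter (isClosed_setOf_le_idealOrder hX hXe hPne ((2 : ℕ) : ℕ∞))) fun y hy => ?_
    have h1 : ζ ⤳ y := specializes_iff_mem_closure.mpr hy.1
    refine hcoh2 ζ (Finset.mem_coe.mp hζ) y h1 fun hyζ => ?_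
    subst hyζ
    -- at `ζ` itself the order of `𝓘_{E_ζ}` is `1`
    have hord : ((2 : ℕ) : ℕ∞) ≤ idealOrder (primeDivisorIdeal y) y := hy.2
    rw [le_idealOrder_iff, stalkIdeal_primeDivisorIdeal_self] at hord
    haveI : IsRegularLocalRing (A.Z.presheaf.stalk y) := hX y
    have hnf : ¬ IsField (A.Z.presheaf.stalk y) := by
      intro hf
      have hm0 := (IsLocalRing.isField_iff_maximalIdeal_eq).mp hf
      have hsupp : y ∈ J.support := hζ'.1
      rw [mem_support_iff_stalkIdeal_le] at hsupp
      apply stalkIdeal_ne_bot_of_ne_bot hJ y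
      exact le_bot_iff.mp (hsupp.trans (le_of_eq hm0))
    exact maximalIdeal_pow_succ_ne hnf 1 (le_antisymm (Ideal.pow_le_pow_right (by omega)) (by rwa [pow_one]))
  refine (hfin₁.union (hfin₂.union hfin₃)).subset ?_
  -- the positive locus lies in the union
  intro y hy
  by_contra hyS
  simp only [Set.mem_union, not_or] at hyS
  obtain ⟨hy₁, hy₂, hy₃⟩ := hyS
  apply (Nat.pos_iff_ne_zero.mp hy)
  haveI hreg : IsRegularLocalRing (A.Z.presheaf.stalk y) := hX y
  -- `J_y = H_y`
  have hJy : stalkIdeal J y = stalkIdeal (divisorialPart J) y := by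
    conv_lhs => rw [← divisorialPart_mul_codimTwoPart hX hJ]
    rw [stalkIdeal_mul, stalkIdeal_eq_top_of_not_mem_support hy₁, Ideal.mul_top]
  -- `H_y = ∏_{ζ ⤳ y} p_ζ^{a_ζ}`
  have hHy : stalkIdeal (divisorialPart J) y = ∏ ζ ∈ F, stalkIdeal (primeDivisorIdeal ζ) y ^ (idealOrder J ζ).toNat := by
    rw [divisorialPart_eq hfin, stalkIdeal_finset_prod]
    refine Finset.prod_congr rfl fun ζ _ => ?_
    rw [stalkIdeal_pow]
  -- which `ζ ∈ F` specialise to `y`? at most one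
  have huniq : ∀ ζ ∈ F, ∀ ζ' ∈ F, ζ ⤳ y → ζ' ⤳ y → ζ = ζ' := by
    intro ζ hζ ζ' hζ' h1 h2
    by_contra hne
    apply hy₂
    rw [hS₂]
    refine Set.mem_iUnion₂.mpr ⟨ζ, hζ, Set.mem_iUnion₂.mpr ⟨ζ', hζ', ?_⟩⟩
    rw [if_neg hne]
    exact ⟨specializes_iff_mem_closure.mp h1, specializes_iff_mem_closure.mp h2⟩
  by_cases hex : ∃ ζ ∈ F, ζ ⤳ y
  · obtain ⟨ζ₀, hζ₀, hsp₀⟩ := hex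
    have hζ₀' := (hmemF ζ₀).mp hζ₀
    obtain ⟨q, hq, hIq⟩ := exists_stalkIdeal_primeDivisorIdeal_eq_span hX.uniqueFactorizationMonoid_stalk hsp₀ hζ₀'.2
    -- `J_y = (q^a)`
    have hJq : stalkIdeal J y = Ideal.span {q ^ (idealOrder J ζ₀).toNat} := by
      rw [hJy, hHy, Finset.prod_eq_single ζ₀, hIq, Ideal.span_singleton_pow]
      · intro ζ hζ hne
        have hns : ¬ ζ ⤳ y := fun h => hne (huniq ζ hζ ζ₀ hζ₀ h hsp₀)
        rw [stalkIdeal_primeDivisorIdeal_eq_top hns, Ideal.top_pow, Ideal.one_eq_top]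
      · intro h; exact absurd hζ₀ h
    -- `q ∉ 𝔪²`
    have hq2 : q ∉ maximalIdeal (A.Z.presheaf.stalk y) ^ 2 := by
      intro hq2
      apply hy₃
      rw [hS₃]
      refine Set.mem_iUnion₂.mpr ⟨ζ₀, hζ₀, specializes_iff_mem_closure.mp hsp₀, ?_⟩
      change ((2 : ℕ) : ℕ∞) ≤ idealOrder (primeDivisorIdeal ζ₀) y
      rw [le_idealOrder_iff, hIq, Ideal.span_singleton_le_iff_mem]
      exact hq2
    refine looseGermMeasure_eq_zero_of_not_le ?_
    rw [hJq]
    exact normalForm_span_pow_not_le hb hq hq2 _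
  · -- no prime divisor through `y`: `J_y = 𝒪`
    push Not at hex
    have hJtop : stalkIdeal J y = ⊤ := by
      rw [hJy, hHy, ← Ideal.one_eq_top]
      refine Finset.prod_eq_one fun ζ hζ => ?_
      rw [stalkIdeal_primeDivisorIdeal_eq_top (hex ζ hζ), Ideal.top_pow, Ideal.one_eq_top]
    refine looseGermMeasure_eq_zero_of_not_le fun hle => ?_
    rw [hJtop] at hle
    have h1 : (⊤ : Ideal (A.Z.presheaf.stalk y)) ≤ maximalIdeal _ ^ E.b := (le_normalForm E.b ⊤).trans hle
    have h2 : (⊤ : Ideal (A.Z.presheaf.stalk y)) ≤ maximalIdeal _ :=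
      h1.trans (Ideal.pow_le_self (Nat.pos_iff_ne_zero.mp hb))
    exact (maximalIdeal.isMaximal (A.Z.presheaf.stalk y)).ne_top (top_le_iff.mp h2)

end CampaignW46

end Summit.ResolutionOfSingularities.ResolutionOfSingularities.Theorems

end
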